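import Mathlib
import Summits.BirchSwinnertonDyer.BirchSwinnertonDyer.Theorems.ResidualThetaTransportAtTwoSignedMuSeedAtTwoPlusNonsquareDescentGrowthLowerBound
import Summits.BirchSwinnertonDyer.BirchSwinnertonDyer.Theorems.ResidualThetaTransportAtTwoSignedMuSeedAtTwoPlusNonsquareDescentModPStructure
import HarnessLib

/-!
# Non-square descent — THE GROWTH DICHOTOMY FOR `M/pM` OVER `k⟦X⟧`: TORSION (⟹ linear growth, `μ = 0`) OR A FREE QUOTIENT (⟹ `#k^{pⁿ} ∣ #(M/ω_nM)`,
# `μ ≥ 1`) — stubs S2/S3 of the line card `nonsquare-descent`, seed crux `SignedMuSeedAtTwoPlus` stmt-BirchSwinnertonDyer-21438 (parent Kμ⁺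
# `SignedMuVanishingAtTwoPlus` stmt-BirchSwinnertonDyer-20689, route ResidualThetaTransportAtTwo)

Cell `bsd-wall`, width seat `bsd-wall-rtt-p4-w2` g18 (`--supports`, closes nothing).  THEOREMS ONLY; BSD is not proved by this and
nothing arithmetic is asserted: module algebra over a PID / `k⟦X⟧`.

For the card's `Q'` (any `R`-module `M` with a quotient `q : M ↠ V`, `V = M/pM`, carrying a compatible f.g. `k⟦X⟧`-structure, `k` finite of
characteristic `p`, `φ T = X`): over the PID `k⟦X⟧` the module `V` is EITHER torsion — then `Theorems/…GrowthCertificate.lean` gives linear growth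
of `ord #(M/ω_nM)` («`μ(Q') = 0`», the `∃ m GNS(m)` branch of S3) — OR it has a quotient `≃ k⟦X⟧` — then `#k^{pⁿ} ∣ #(M/ω_nM)` for all `n`
(`…GrowthLowerBound.lean`; «`u_∞ ∈ 2Ē^χ`, `μ ≥ 1`», the `¬GNS` branch).  This file supplies the PID fact and the composed dichotomy.

* §0 `moduleFinite_of_compatible` — a compatible `S`-structure on an `R`-quotient of a f.g. module is f.g.; `exists_linearMap_of_compatible` —
  `R`-linear maps between compatible modules are `S`-linear (`φ` surjective).
* §1 **`exists_surjective_of_not_torsion`** — a finitely generated module over a PID that is not torsion SURJECTS onto the ring (structure theorem,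
  free rank `≥ 1`).
* §2 `natCard_quotient_smul_dvd_of_surjective` — an `S`-linear surjection `V ↠ W` gives `#(W/aW) ∣ #(V/aV)`.
* §3 **`torsion_or_pow_dvd_natCard_quotient_omega`** — the dichotomy for `M ↠ V` as above.

[folklore]
-/

set_option autoImplicit false
-- the Theorems namespace of this sub repeats the summit name by design (D-0017 nested layout)
set_option linter.dupNamespace false

open scoped Pointwise DirectSum

universe u v

namespace Summit.BirchSwinnertonDyer.BirchSwinnertonDyer.Theorems.SignedMuAtTwo.NonsquareDescent

/-! ## §0 Bookkeeping: a compatible `S`-structure on a quotient of a f.g. `R`-module is f.g. -/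

section CompatibleFinite

variable {R : Type*} [CommRing R] {M : Type*} [AddCommGroup M] [Module R M]
  {S : Type*} [CommRing S] {V : Type*} [AddCommGroup V] [Module R V] [Module S V]

/-- If `q : M ↠ V` is `R`-linear, `M` is finitely generated over `R`, `φ : R ↠ S` is surjective and the `S`-structure on `V` is compatible
(`r • v = φ r • v`), then `V` is finitely generated over `S` (the images of `R`-generators generate) — the instance `Module.Finite k⟦X⟧ (Q'/pQ')`
required by `…GrowthCertificate` / the dichotomy below, for the structure produced by `exists_module_compatible_mkQ`. [folklore] -/
theorem moduleFinite_of_compatible [Module.Finite R M] (φ : R →+* S)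
    (hcompat : ∀ (r : R) (v : V), r • v = φ r • v) (q : M →ₗ[R] V) (hq : Function.Surjective q) :
    Module.Finite S V := by
  classical
  obtain ⟨s, hs⟩ := Module.Finite.fg_top (R := R) (M := M)
  refine ⟨⟨s.image q, ?_⟩⟩
  rw [eq_top_iff]
  rintro v -
  obtain ⟨m, rfl⟩ := hq v
  have hm : m ∈ Submodule.span R (s : Set M) := by rw [hs]; exact Submodule.mem_top
  induction hm using Submodule.span_induction with
  | mem x hx => exact Submodule.subset_span (by rw [Finset.coe_image]; exact Set.mem_image_of_mem q hx)
  | zero => rw [map_zero]; exact Submodule.zero_mem _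
  | add x y _ _ hx hy => rw [map_add]; exact Submodule.add_mem _ hx hy
  | smul r x _ hx => rw [map_smul, hcompat]; exact Submodule.smul_mem _ _ hx

/-- An `R`-linear map between modules carrying `φ`-compatible `S`-structures (`φ : R ↠ S` surjective) IS `S`-linear: there is `g : V →ₗ[S] W` with the
same underlying function (existential, no definition) — how a LEAD turns the `Λ'`-linear projections `Ē^χ/2 → 𝓔_n^χ/2` into the `𝔽₄⟦T⟧`-linear `π n`
of the certificate. [folklore] -/
theorem exists_linearMap_of_compatible {W : Type*} [AddCommGroup W] [Module R W] [Module S W]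
    (φ : R →+* S) (hφs : Function.Surjective φ)
    (hV : ∀ (r : R) (v : V), r • v = φ r • v) (hW : ∀ (r : R) (w : W), r • w = φ r • w) (f : V →ₗ[R] W) :
    ∃ g : V →ₗ[S] W, ∀ v : V, g v = f v := by
  refine ⟨{ toFun := f, map_add' := f.map_add, map_smul' := fun c v => ?_ }, fun v => rfl⟩
  obtain ⟨r, rfl⟩ := hφs c
  rw [RingHom.id_apply, ← hV, map_smul, hW]

end CompatibleFinite

/-! ## §1 Not torsion ⟹ surjects onto the ring (PID) -/

section PID

variable {S : Type u} [CommRing S] [IsDomain S] [IsPrincipalIdealRing S] {V : Type v} [AddCommGroup V] [Module S V]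

/-- **Over a PID, a finitely generated module which is not torsion surjects `S`-linearly onto `S`**: in `V ≃ Sⁿ × ⨁ S/(pᵢ^{eᵢ})` the free rank `n`
is `≥ 1` (otherwise `∏ pᵢ^{eᵢ} ≠ 0` kills `V`), and the first coordinate is the surjection. [folklore] -/
theorem exists_surjective_of_not_torsion [Module.Finite S V] (hV : ∃ v : V, ∀ b : S, b ≠ 0 → b • v ≠ 0) :
    ∃ σ : V →ₗ[S] S, Function.Surjective σ := by
  classical
  obtain ⟨n, ι, _, p, hp, e, ⟨f⟩⟩ := Module.equiv_free_prod_directSum S V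
  have hc : (∏ i, p i ^ e i) ≠ 0 :=
    Finset.prod_ne_zero_iff.mpr fun i _ => pow_ne_zero _ (hp i).ne_zero
  rcases Nat.eq_zero_or_pos n with hn | hn
  · exfalso
    subst hn
    obtain ⟨v, hv⟩ := hV
    apply hv _ hc
    apply f.injective
    rw [map_smul, map_zero, Prod.ext_iff]
    refine ⟨Finsupp.ext fun i => Fin.elim0 i, ?_⟩
    rw [Prod.smul_snd, Prod.snd_zero, prod_pow_smul_directSum_eq_zero]
  · refine ⟨(Finsupp.lapply (⟨0, hn⟩ : Fin n)).comp ((LinearMap.fst S _ _).comp f.toLinearMap), fun s => ?_⟩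
    refine ⟨f.symm (Finsupp.single ⟨0, hn⟩ s, 0), ?_⟩
    simp only [LinearMap.comp_apply, LinearEquiv.coe_coe, LinearEquiv.apply_symm_apply, LinearMap.fst_apply,
      Finsupp.lapply_apply, Finsupp.single_eq_same]

end PID

/-! ## §2 Surjections and `#(·/a·)` -/

section Surj

variable {S : Type*} [CommRing S] {V : Type*} [AddCommGroup V] [Module S V] {W : Type*} [AddCommGroup W] [Module S W]

/-- An `S`-linear surjection `σ : V ↠ W` induces `V/aV ↠ W/aW`, so `#(W/aW) ∣ #(V/aV)` (`Nat.card`). [folklore] -/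
theorem natCard_quotient_smul_dvd_of_surjective (σ : V →ₗ[S] W) (hσ : Function.Surjective σ) (a : S) :
    Nat.card (W ⧸ (a • (⊤ : Submodule S W))) ∣ Nat.card (V ⧸ (a • (⊤ : Submodule S V))) := by
  have hle : a • (⊤ : Submodule S V) ≤ (a • (⊤ : Submodule S W)).comap σ := by
    rw [← Submodule.map_le_iff_le_comap, Submodule.map_pointwise_smul, Submodule.map_top, LinearMap.range_eq_top.mpr hσ]
  refine AddSubgroup.card_dvd_of_surjective (Submodule.mapQ _ _ σ hle).toAddMonoidHom fun q => ?_
  obtain ⟨w, rfl⟩ := Submodule.mkQ_surjective _ q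
  obtain ⟨v, rfl⟩ := hσ w
  exact ⟨Submodule.Quotient.mk v, rfl⟩

end Surj

/-! ## §3 The dichotomy -/

section Dichotomy

variable {R : Type*} [CommRing R] {M : Type*} [AddCommGroup M] [Module R M]
  {k : Type u} [Field k] [Finite k] (p : ℕ) [Fact p.Prime] [CharP k p]
  {V : Type v} [AddCommGroup V] [Module R V] [Module (PowerSeries k) V]

/-- **GROWTH DICHOTOMY.**  `φ : R →+* k⟦X⟧` with `φ T = X` (`k` finite, `char k = p`), `q : M ↠ V` `R`-linear, `V` finitely generated over `k⟦X⟧` with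
`r • v = φ r • v`.  Then EITHER every element of `V` is `k⟦X⟧`-torsion («`μ = 0`»: with `V = Q'/pQ'` this feeds `…GrowthCertificate`, linear growth),
OR `#k^{pⁿ} ∣ #(M/ω_nM)` for every `n` («`μ ≥ 1`»: exponential growth), `ω_n = (1+T)^{pⁿ} − 1`. [folklore] -/
theorem torsion_or_pow_dvd_natCard_quotient_omega [Module.Finite (PowerSeries k) V]
    (φ : R →+* PowerSeries k) (hcompat : ∀ (r : R) (v : V), r • v = φ r • v) {T : R} (hTX : φ T = PowerSeries.X)
    (q : M →ₗ[R] V) (hq : Function.Surjective q) :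
    (∀ v : V, ∃ b : PowerSeries k, b ≠ 0 ∧ b • v = 0) ∨
      ∀ n : ℕ, Nat.card k ^ (p ^ n) ∣ Nat.card (M ⧸ (((1 + T) ^ (p ^ n) - 1) • (⊤ : Submodule R M))) := by
  by_cases htor : ∀ v : V, ∃ b : PowerSeries k, b ≠ 0 ∧ b • v = 0
  · exact Or.inl htor
  · right
    push Not at htor
    obtain ⟨v, hv⟩ := htor
    obtain ⟨σ, hσ⟩ := exists_surjective_of_not_torsion (S := PowerSeries k) ⟨v, fun b hb h => hv b hb h⟩
    intro n
    -- `M/ω_nM ↠ V/φ(ω_n)V ↠ k⟦X⟧/(φ(ω_n)) = k⟦X⟧/(X^{pⁿ})`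
    have h1 := natCard_quotient_dvd_of_surjective φ hcompat q hq ((1 + T) ^ (p ^ n) - 1)
    have h2 := natCard_quotient_smul_dvd_of_surjective σ hσ (φ ((1 + T) ^ (p ^ n) - 1))
    have h3 := natCard_line_quotient_omega p (W := PowerSeries k) (LinearEquiv.refl (PowerSeries k) (PowerSeries k)) n
    rw [map_sub, map_pow, map_add, map_one, hTX] at h2
    rw [h3] at h2
    rw [map_sub, map_pow, map_add, map_one, hTX] at h1
    exact h2.trans h1

end Dichotomy

end Summit.BirchSwinnertonDyer.BirchSwinnertonDyer.Theorems.SignedMuAtTwo.NonsquareDescent
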